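import Summits.NavierStokesRegularity.FunctionalMining.NoGo.TopEigHeatKillingShape
import HarnessLib

/-!
# FunctionalMining / NoGo — PROFILE RIGIDITY OF A KILL, every real `q > 1`: along every killing
# sequence for Lemma L-λ(q) the `L^q`-NORMALISED TOP EIGENVALUE IS ASYMPTOTICALLY CONSTANT
# (`∫ ((λ₁⁺)^{q/2}/√Φ_q − 1)² → 0`, and `vol{|λ₁⁺/Φ_q^{1/q} − 1| ≥ ε} → 0` for every `ε > 0`)

Search for candidate a priori estimates; no regularity claim. Cell `pub-nsfunc`, no-go seat
(gen 53), STAGED for the prove seat. A finite statement about smooth divergence-free fields on `T³`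
and the static functional `Φ_q = ∫ (λ₁⁺)^q`; nothing about Navier–Stokes is proved or asserted, and
NO node of the lane is decided here: the hypothesis of the main theorem is the OPEN negation
`¬ TopEigHeatCoercivePos q`.

THE POINT. `NoGo/TopEigHeatKillingShape` (K59) typed the search space of door (F2): Lemma L-λ(q)
fails iff a KILLING SEQUENCE exists (zero-mean admissible `v n`, `Φ_q(v n) > 0`,
`heatDissipation Φ_q (v n) / Φ_q(v n) → 0`), and every killing sequence FLATTENS:
`Φ_{q/2}(v n)² / Φ_q(v n) → 1` (K58ʼs rate (R12) for every real `q > 1`). `NoGo/TopEigHeatIsoTopLow`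
(K57b) drew the portrait of an EXACT witness (`heatDissipation = 0` forces `λ₁ ≡ const`). This file
is the STABILITY form of that portrait, in the only norm the functional sees: write
`f_n := (λ₁(v n)⁺)^{q/2}` (so `∫ f_n² = Φ_q`, `∫ f_n = Φ_{q/2}`) and `g_n := f_n / √Φ_q(v n)` (unit
`L²` norm). Expanding the square on the unit-volume torus,
  `∫ (g_n − 1)² = 2 − 2 · Φ_{q/2}(v n) / √Φ_q(v n)`            (`profileDeficit_eq`),
and flattening says `Φ_{q/2}/√Φ_q = √(Φ_{q/2}²/Φ_q) → 1`. HENCE ALONG EVERY KILLING SEQUENCE THE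
NORMALISED PROFILE CONVERGES TO THE CONSTANT FUNCTION `1` IN `L²(T³)`, so (Chebyshev, and the
continuity of `s ↦ s^{2/q}` at `1`) THE TOP EIGENVALUE IS ASYMPTOTICALLY THE CONSTANT `Φ_q^{1/q}` IN
MEASURE: for every `ε > 0`, `vol{x : ε ≤ |λ₁(x)⁺/Φ_q^{1/q} − 1|} → 0`. In words: a kernel kill of
L-λ(q), at any real `q > 1`, must be carried by fields whose top strain eigenvalue is, after
normalisation, ASYMPTOTICALLY CONSTANT over the whole torus — asymptotically an exact witness in
profile. Every recorded construction class with a non-constant limiting profile (two-phase laminates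
with unequal top eigenvalues, localised / concentrating families, fields vanishing on a set of fixed
positive measure) is therefore not a refutation, for a reason stated once, on the node, for all real
`q > 1`. The frame (eigenvector field) is NOT constrained by anything in this file.

CONTENT (namespace `Summit.NavierStokesRegularity.FunctionalMining.TopEig.KillingProfile`):
* `continuous_posPart_topEig_rpow`,
  `profile_rpow_two_div` (`((a^{q/2})/√Φ)^{2/q} = a/Φ^{1/q}`) — bookkeeping;
* **`profileDeficit_eq`** — for smooth `v` with `Φ_q(v) > 0` (any real `q ≥ 0`):
  `∫ ((λ₁⁺)^{q/2}/√Φ_q − 1)² = 2 − 2 · Φ_{q/2}/√Φ_q`;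
* `tendsto_moment_div_sqrt_of_killing` — `Φ_{q/2}(v n)/√Φ_q(v n) → 1` along a killing sequence
  (real `q > 1`; K59 `tendsto_moment_ratio_of_killing` and `√`);
* **`tendsto_profileDeficit_of_killing`** — `∫ (g_n − 1)² → 0` along every killing sequence;
* `tendsto_measureReal_profile_far_of_killing` — `vol{ε ≤ |g_n − 1|} → 0`, every `ε > 0`;
* **`tendsto_measureReal_topEig_far_of_killing`** — `vol{ε ≤ |λ₁⁺/Φ_q^{1/q} − 1|} → 0`, every
  `ε > 0`;
* **`killing_profile_of_not_coercivePos (hq : 1 < q) (h : ¬ TopEigHeatCoercivePos q)`** — on the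
  node: `∃` a killing sequence (K59) along which the normalised profile tends to `1` in `L²` and
  `λ₁⁺/Φ_q^{1/q} → 1` in measure.

Honest reading. STRUCTURE ONLY: the main theorem takes the OPEN negation as hypothesis; L-λ(q)
stays OPEN in the kernel for every real `q > 1`; no 𝒦₀ row, no A12 count, no T_LD input. [ours]
FILING (prove seat g33, REQUEST #89 v3, GRANT LEAD (59ad) INBOX l.5894): declarations byte-identical to the prove-cut `pub-nsfunc-prove/staged/g33-filings/TopEigHeatKillingProfile.v3.lean` 234158582b8d8827 (= nogo K60 staged 2538bd10ed2b8ced with the Literature twin `rpow_half_sq_eq_rpow` inlined per (59aa)(2), DELTA `K60v3-DELTA.md`); this line is the only addition.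
-/

noncomputable section

open MeasureTheory Filter Topology Set
open Literature.Analysis.FunctionSpaces

namespace Summit.NavierStokesRegularity.FunctionalMining.TopEig

namespace KillingProfile

/-! ## § 1 The profile deficit identity (one field, any real `q`) -/

section Identity

variable {q : ℝ} {v : UnitAddTorus (Fin 3) → EuclideanSpace ℝ (Fin 3)}

/-- Continuity of `x ↦ (λ₁(x)⁺)^p`, `p ≥ 0`, for smooth `v`. [folklore] -/
theorem continuous_posPart_topEig_rpow (hv : Torus.IsSmooth v) {p : ℝ} (hp : 0 ≤ p) :
    Continuous fun x => (max (torusStrainTopEig v x) 0) ^ p :=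
  ((continuous_torusStrainTopEig hv).max continuous_const).rpow_const fun _ => Or.inr hp

/-- **The profile deficit identity.** For smooth `v` with `Φ_q(v) > 0`, the unit-`L²` profile
`g := (λ₁⁺)^{q/2} / √Φ_q` satisfies `∫ (g − 1)² = 2 − 2 · Φ_{q/2}(v) / √Φ_q(v)` (unit-volume torus;
`∫ g² = 1`, `∫ g = Φ_{q/2}/√Φ_q`). [ours] -/
theorem profileDeficit_eq (hv : Torus.IsSmooth v) (hq : 0 ≤ q) (hΦ : 0 < torusTopEigMoment q v) :
    ∫ x, ((max (torusStrainTopEig v x) 0) ^ (q / 2) / Real.sqrt (torusTopEigMoment q v) - 1) ^ 2 =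
      2 - 2 * (torusTopEigMoment (q / 2) v / Real.sqrt (torusTopEigMoment q v)) := by
  set Φ := torusTopEigMoment q v with hΦdef
  set f : UnitAddTorus (Fin 3) → ℝ := fun x => (max (torusStrainTopEig v x) 0) ^ (q / 2) with hfdef
  have hfc : Continuous f := continuous_posPart_topEig_rpow hv (by linarith)
  have hsq : ∀ {a : ℝ}, 0 ≤ a → (a ^ (q / 2)) ^ 2 = a ^ q := fun ha => by
    rw [← Real.rpow_two, ← Real.rpow_mul ha]; congr 1; ring
  have hf2 : ∫ x, f x ^ 2 = Φ := by
    simp only [hfdef, hsq (le_max_right _ _)]; rfl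
  have hf1 : ∫ x, f x = torusTopEigMoment (q / 2) v := rfl
  have hexp : (fun x => ((max (torusStrainTopEig v x) 0) ^ (q / 2) / Real.sqrt Φ - 1) ^ 2) =
      fun x => (f x ^ 2 / Φ - 2 * (f x / Real.sqrt Φ)) + 1 := by
    funext x
    have h1 : (f x / Real.sqrt Φ - 1) ^ 2 =
        (f x ^ 2 / (Real.sqrt Φ) ^ 2 - 2 * (f x / Real.sqrt Φ)) + 1 := by ring
    rw [Real.sq_sqrt hΦ.le] at h1
    simpa only [hfdef] using h1
  have hi1 : Integrable (fun x => f x ^ 2 / Φ) := ((hfc.pow 2).div_const Φ).integrable_unitAddTorus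
  have hi2 : Integrable (fun x => 2 * (f x / Real.sqrt Φ)) :=
    (continuous_const.mul (hfc.div_const _)).integrable_unitAddTorus
  have hi12 : Integrable (fun x => f x ^ 2 / Φ - 2 * (f x / Real.sqrt Φ)) := hi1.sub hi2
  rw [hexp, integral_add hi12 (integrable_const 1), integral_sub hi1 hi2, integral_div, hf2,
    div_self hΦ.ne', integral_const_mul, integral_div, hf1]
  simp only [integral_const, probReal_univ, smul_eq_mul, one_mul]
  ring

end Identity

/-! ## § 2 Along a killing sequence (real `q > 1`, `T³`) -/

section Killing

variable {q : ℝ} {v : ℕ → UnitAddTorus (Fin 3) → EuclideanSpace ℝ (Fin 3)}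

/-- `Φ_{q/2}(v n) / √Φ_q(v n) → 1` along a killing sequence (`= √(Φ_{q/2}²/Φ_q)`, and K59ʼs
`tendsto_moment_ratio_of_killing`). [ours] -/
theorem tendsto_moment_div_sqrt_of_killing (hq : 1 < q) (hv : ∀ n, Torus.IsSmooth (v n))
    (hdv : ∀ n, Torus.IsDivFree (v n)) (hΦ : ∀ n, 0 < torusTopEigMoment q (v n))
    (hkill : Tendsto
      (fun n => heatDissipation (torusTopEigMoment q) (v n) / torusTopEigMoment q (v n))
      atTop (𝓝 0)) :
    Tendsto (fun n => torusTopEigMoment (q / 2) (v n) / Real.sqrt (torusTopEigMoment q (v n)))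
      atTop (𝓝 1) := by
  have h := (KillingShape.tendsto_moment_ratio_of_killing hq hv hdv hΦ hkill).sqrt
  rw [Real.sqrt_one] at h
  refine h.congr fun n => ?_
  rw [Real.sqrt_div' _ (hΦ n).le, Real.sqrt_sq (torusTopEigMoment_nonneg _ _)]

/-- **`L²` PROFILE RIGIDITY: `∫ ((λ₁⁺)^{q/2}/√Φ_q − 1)² → 0` along every killing sequence**
(real `q > 1`). [ours] -/
theorem tendsto_profileDeficit_of_killing (hq : 1 < q) (hv : ∀ n, Torus.IsSmooth (v n))
    (hdv : ∀ n, Torus.IsDivFree (v n)) (hΦ : ∀ n, 0 < torusTopEigMoment q (v n))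
    (hkill : Tendsto
      (fun n => heatDissipation (torusTopEigMoment q) (v n) / torusTopEigMoment q (v n))
      atTop (𝓝 0)) :
    Tendsto (fun n => ∫ x, ((max (torusStrainTopEig (v n) x) 0) ^ (q / 2) /
        Real.sqrt (torusTopEigMoment q (v n)) - 1) ^ 2) atTop (𝓝 0) := by
  have h := ((tendsto_moment_div_sqrt_of_killing hq hv hdv hΦ hkill).const_mul 2).const_sub 2
  rw [show (2 : ℝ) - 2 * 1 = 0 by norm_num] at h
  exact h.congr fun n => (profileDeficit_eq (hv n) (by linarith) (hΦ n)).symm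

/-- **PROFILE RIGIDITY IN MEASURE: `vol{x : ε ≤ |(λ₁⁺)^{q/2}/√Φ_q − 1|} → 0`** for every `ε > 0`
along every killing sequence (Chebyshev on the `L²` deficit). [ours] -/
theorem tendsto_measureReal_profile_far_of_killing (hq : 1 < q) (hv : ∀ n, Torus.IsSmooth (v n))
    (hdv : ∀ n, Torus.IsDivFree (v n)) (hΦ : ∀ n, 0 < torusTopEigMoment q (v n))
    (hkill : Tendsto
      (fun n => heatDissipation (torusTopEigMoment q) (v n) / torusTopEigMoment q (v n))
      atTop (𝓝 0)) {ε : ℝ} (hε : 0 < ε) :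
    Tendsto (fun n => volume.real {x | ε ≤ |(max (torusStrainTopEig (v n) x) 0) ^ (q / 2) /
        Real.sqrt (torusTopEigMoment q (v n)) - 1|}) atTop (𝓝 0) := by
  set D : ℕ → ℝ := fun n => ∫ x, ((max (torusStrainTopEig (v n) x) 0) ^ (q / 2) /
      Real.sqrt (torusTopEigMoment q (v n)) - 1) ^ 2 with hD
  have hDlim : Tendsto (fun n => D n / ε ^ 2) atTop (𝓝 0) := by
    simpa using (tendsto_profileDeficit_of_killing hq hv hdv hΦ hkill).div_const (ε ^ 2)
  refine squeeze_zero (fun n => measureReal_nonneg) (fun n => ?_) hDlim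
  set g : UnitAddTorus (Fin 3) → ℝ := fun x => (max (torusStrainTopEig (v n) x) 0) ^ (q / 2) /
      Real.sqrt (torusTopEigMoment q (v n)) - 1 with hg
  have hgc : Continuous g :=
    ((continuous_posPart_topEig_rpow (hv n) (by linarith)).div_const _).sub continuous_const
  -- Chebyshev for `(g − 1)²` at level `ε²`, and `{ε ≤ |g|} ⊆ {ε² ≤ g²}`
  have hcheb := mul_meas_ge_le_integral_of_nonneg (μ := volume)
    (Eventually.of_forall fun x => sq_nonneg (g x)) ((hgc.pow 2).integrable_unitAddTorus) (ε ^ 2)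
  have hsub : {x | ε ≤ |g x|} ⊆ {x | ε ^ 2 ≤ g x ^ 2} := fun x hx => by
    have h := pow_le_pow_left₀ hε.le (hx : ε ≤ |g x|) 2
    simpa [sq_abs] using h
  have hmono : volume.real {x | ε ≤ |g x|} ≤ volume.real {x | ε ^ 2 ≤ g x ^ 2} :=
    measureReal_mono hsub
  rw [le_div_iff₀ (pow_pos hε 2), mul_comm]
  exact (mul_le_mul_of_nonneg_left hmono (pow_pos hε 2).le).trans hcheb

/-- `((a^{q/2}) / √Φ)^{2/q} = a / Φ^{1/q}` for `a ≥ 0`, `Φ ≥ 0`, `q ≠ 0`. [folklore] -/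
theorem profile_rpow_two_div (hq : q ≠ 0) {a Φ : ℝ} (ha : 0 ≤ a) (hΦ : 0 ≤ Φ) :
    (a ^ (q / 2) / Real.sqrt Φ) ^ (2 / q) = a / Φ ^ (1 / q) := by
  rw [Real.div_rpow (Real.rpow_nonneg ha _) (Real.sqrt_nonneg _), ← Real.rpow_mul ha,
    Real.sqrt_eq_rpow, ← Real.rpow_mul hΦ]
  congr 1
  · rw [show q / 2 * (2 / q) = 1 by field_simp, Real.rpow_one]
  · congr 1; field_simp

/-- **THE TOP EIGENVALUE IS ASYMPTOTICALLY THE CONSTANT `Φ_q^{1/q}` IN MEASURE: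
`vol{x : ε ≤ |λ₁(x)⁺ / Φ_q^{1/q} − 1|} → 0`** for every `ε > 0` along every killing sequence (real
`q > 1`; the previous theorem read through the continuity of `s ↦ s^{2/q}` at `s = 1`). [ours] -/
theorem tendsto_measureReal_topEig_far_of_killing (hq : 1 < q) (hv : ∀ n, Torus.IsSmooth (v n))
    (hdv : ∀ n, Torus.IsDivFree (v n)) (hΦ : ∀ n, 0 < torusTopEigMoment q (v n))
    (hkill : Tendsto
      (fun n => heatDissipation (torusTopEigMoment q) (v n) / torusTopEigMoment q (v n))
      atTop (𝓝 0)) {ε : ℝ} (hε : 0 < ε) :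
    Tendsto (fun n => volume.real {x | ε ≤ |max (torusStrainTopEig (v n) x) 0 /
        torusTopEigMoment q (v n) ^ (1 / q) - 1|}) atTop (𝓝 0) := by
  have hq0 : q ≠ 0 := by positivity
  -- continuity of `s ↦ s^{2/q}` at `1`
  have hcont : ContinuousAt (fun s : ℝ => s ^ (2 / q)) 1 :=
    Real.continuousAt_rpow_const 1 (2 / q) (Or.inl one_ne_zero)
  obtain ⟨δ, hδ, hδε⟩ := Metric.continuousAt_iff.1 hcont ε hε
  simp only [Real.one_rpow, Real.dist_eq] at hδε
  refine squeeze_zero (fun n => measureReal_nonneg) (fun n => measureReal_mono fun x hx => ?_)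
    (tendsto_measureReal_profile_far_of_killing hq hv hdv hΦ hkill hδ)
  -- contrapositive of the `δ`–`ε` implication at the point `x`
  by_contra hlt
  have hlt' : |max (torusStrainTopEig (v n) x) 0 ^ (q / 2) /
      Real.sqrt (torusTopEigMoment q (v n)) - 1| < δ := not_le.1 hlt
  have h := hδε hlt'
  rw [profile_rpow_two_div hq0 (le_max_right _ _) (hΦ n).le] at h
  exact (not_lt.2 hx) h

/-- **PROFILE RIGIDITY OF A KILL, every real `q > 1`, on the node.** If Lemma L-λ(q) FAILS, there is
a killing sequence (K59 `killing_shape_of_not_coercivePos`: zero-mean admissible, `Φ_q > 0`,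
`heatDissipation/Φ_q → 0`) along which the `L^q`-normalised top-eigenvalue profile is asymptotically
the constant `1` — `∫ ((λ₁⁺)^{q/2}/√Φ_q − 1)² → 0` — and the top eigenvalue is asymptotically
the constant `Φ_q^{1/q}` in measure: `vol{ε ≤ |λ₁⁺/Φ_q^{1/q} − 1|} → 0` for every `ε > 0`.
Hypothesis = the OPEN negation; NO node decided. [ours] -/
theorem killing_profile_of_not_coercivePos (hq : 1 < q)
    (h : ¬ TopEigHeatCoercivePos (d := Fin 3) q) :
    ∃ v : ℕ → UnitAddTorus (Fin 3) → EuclideanSpace ℝ (Fin 3),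
      (∀ n, Torus.IsSmooth (v n) ∧ Torus.IsDivFree (v n) ∧ Torus.HasZeroMean (v n) ∧
        0 < torusTopEigMoment q (v n)) ∧
      Tendsto (fun n => heatDissipation (torusTopEigMoment q) (v n) / torusTopEigMoment q (v n))
        atTop (𝓝 0) ∧
      Tendsto (fun n => ∫ x, ((max (torusStrainTopEig (v n) x) 0) ^ (q / 2) /
        Real.sqrt (torusTopEigMoment q (v n)) - 1) ^ 2) atTop (𝓝 0) ∧
      ∀ ε : ℝ, 0 < ε → Tendsto (fun n => volume.real {x | ε ≤
        |max (torusStrainTopEig (v n) x) 0 / torusTopEigMoment q (v n) ^ (1 / q) - 1|})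
        atTop (𝓝 0) := by
  obtain ⟨v, hv, hkill, -, -, -⟩ := KillingShape.killing_shape_of_not_coercivePos hq h
  exact ⟨v, hv, hkill,
    tendsto_profileDeficit_of_killing hq (fun n => (hv n).1) (fun n => (hv n).2.1)
      (fun n => (hv n).2.2.2) hkill,
    fun ε hε => tendsto_measureReal_topEig_far_of_killing hq (fun n => (hv n).1)
      (fun n => (hv n).2.1) (fun n => (hv n).2.2.2) hkill hε⟩

end Killing

end KillingProfile

end Summit.NavierStokesRegularity.FunctionalMining.TopEig

end
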